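import Summits.HodgeConjecture.FermatCycles.GHC3Certificates
import HarnessLib

/-!
# Fermat cycles — GHC3: soundness of the certificate check `certOK` (a passing certificate leaves the Fine interior empty)

HONEST FRAMING: explicit algebraic cycles for specific Hodge classes on Fermat/Delsarte varieties;
residual open instances listed; no claim on general Hodge.

Topic path `Summits/HodgeConjecture/FermatCycles/` of cell `pub-hfermat` (new work, not literature). Companion of `GHC3Certificates.lean`
(p214783: the 156 Fine-interior certificates of `pub-hfermat-lit/GHC3-NOTE.md` checked by the Boolean `certOK`, `decide`). Here the Boolean
check is given its MEANING inside Lean: `certOK_sound` — if `certOK m c = true` and `m > 0` then no `x ∈ ℚ⁵` with `x ≥ 0`, `Σ x = m` has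
`v_k·x ≥ m` for every vector `v_k` of the certificate. For the simplex `P(a) = m·Δ₄` in the lattice `M'_a = {u ≡ t·a (mod m)}` the dual vectors
are `v/m`, `v ∈ ℤ⁵`, `a·v ≡ 0 (mod m)`; a non-negative such `v` with a zero entry has minimum `0` on `P(a)`, so a point of the FINE INTERIOR of
`P(a)` satisfies `(v/m)·x ≥ 1`, i.e. `v·x ≥ m`, for all of them — in particular for the certificate's vectors; hence `certOK ⇒ F(P(a)) = ∅`
(`GHC3-PRIME.md` §2 R3, `GHC3-NOTE.md` §1; the same inequality, over abstract `Fin`-indexed data, is search-2's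
`GHC3PrimeCertificates.fine_interior_empty_of_certificate`, p214273). The argument: `W·m ≤ Σ_k w_k (v_k·x) = Σ_j (Σ_k w_k v_{k,j}) x_j ≤ (W − 1)·m`.
ASSEMBLY (appended): `CertifiedWithin m certs` + `certified_<m>` for `m = 11, 13, 15, 16, 17, 19, 21, 23, 24` — every level-one character of `X³ₘ` is
decomposable, quasi-decomposable, or a unit multiple of the character of a `certOK`-passing certificate (from `ResidualWithin` + `certs_<m>_reps` +
`certs_<m>_ok`); `m = 11` is the level Shioda names [Shioda1983WhatIsKnown, (13) p. 64].
Everything downstream of "Fine interior empty" (κ = −∞, uniruledness, coniveau) stays QUOTED as in `GHC3Certificates.lean`.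
-/

namespace Summit.HodgeConjecture.FermatCycles.GHC3CertificateSoundness

open Summit.HodgeConjecture.FermatCycles.GHC3Certificates (Cert certOK)

/-- `v·x` over `ℚ` for a list `v : List ℕ` against `x : Fin 5 → ℚ` (entries of `v` beyond its length count as `0`). [folklore] -/
def dotQ (v : List ℕ) (x : Fin 5 → ℚ) : ℚ := ∑ j : Fin 5, (v.getD j 0 : ℚ) * x j

/-- Linearity: the weighted sum of the `v_k·x` is the sum over columns of (weighted column sum) `· x_j`. [folklore] -/
theorem weightedSum_eq_cols (x : Fin 5 → ℚ) :
    ∀ (ws : List ℕ) (vs : List (List ℕ)),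
      (List.zipWith (fun (w : ℕ) (v : List ℕ) ↦ (w : ℚ) * dotQ v x) ws vs).sum =
        ∑ j : Fin 5, (((List.zipWith (fun w v ↦ w * v.getD j 0) ws vs).sum : ℕ) : ℚ) * x j
  | [], vs => by simp
  | w :: ws, [] => by simp
  | w :: ws, v :: vs => by
    rw [List.zipWith_cons_cons, List.sum_cons, weightedSum_eq_cols x ws vs]
    simp only [List.zipWith_cons_cons, List.sum_cons, Nat.cast_add, Nat.cast_mul, add_mul, Finset.sum_add_distrib,
      dotQ, Finset.mul_sum, mul_assoc]

/-- Lower bound: if every `v_k·x ≥ m` then the weighted sum is `≥ W·m`. [folklore] -/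
theorem weightedSum_ge (x : Fin 5 → ℚ) (m : ℚ) :
    ∀ (ws : List ℕ) (vs : List (List ℕ)), vs.length = ws.length → (∀ v ∈ vs, m ≤ dotQ v x) →
      ((ws.sum : ℕ) : ℚ) * m ≤ (List.zipWith (fun (w : ℕ) (v : List ℕ) ↦ (w : ℚ) * dotQ v x) ws vs).sum
  | [], vs, _, _ => by simp
  | w :: ws, [], hlen, _ => by simp at hlen
  | w :: ws, v :: vs, hlen, hF => by
    rw [List.zipWith_cons_cons, List.sum_cons, List.sum_cons, Nat.cast_add, add_mul]
    have h1 : (w : ℚ) * m ≤ (w : ℚ) * dotQ v x :=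
      mul_le_mul_of_nonneg_left (hF v (List.mem_cons_self)) (Nat.cast_nonneg w)
    have h2 := weightedSum_ge x m ws vs (by simpa using hlen) (fun u hu ↦ hF u (List.mem_cons_of_mem v hu))
    exact add_le_add h1 h2

/-- **Soundness of `certOK`.** If `certOK m c = true` and `m > 0`, there is no `x ∈ ℚ⁵`, `x ≥ 0`, `Σ x = m`, with `v·x ≥ m` for every vector `v`
of the certificate — the Fine interior of `P(a)` is empty (`GHC3-PRIME.md` §2 R3). Proof: `W·m ≤ Σ_k w_k (v_k·x) = Σ_j (Σ_k w_k v_{k,j}) x_j ≤ (W−1)·m`.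
[folklore] -/
theorem certOK_sound {m : ℕ} (hm : 0 < m) {c : Cert} (h : certOK m c = true) (x : Fin 5 → ℚ) (hx : ∀ j, 0 ≤ x j)
    (hsum : ∑ j, x j = m) (hF : ∀ v ∈ c.2.1, (m : ℚ) ≤ dotQ v x) : False := by
  obtain ⟨a, vs, ws⟩ := c
  simp only [certOK, Bool.and_eq_true, List.all_eq_true, decide_eq_true_eq, beq_iff_eq] at h
  obtain ⟨⟨⟨⟨-, hlen⟩, -⟩, -⟩, hcols⟩ := h
  have h1 := weightedSum_ge x m ws vs hlen hF
  have h2 := weightedSum_eq_cols x ws vs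
  have h3 : ∑ j : Fin 5, (((List.zipWith (fun w v ↦ w * v.getD j 0) ws vs).sum : ℕ) : ℚ) * x j ≤
      ∑ j : Fin 5, ((ws.sum : ℕ) - 1 : ℚ) * x j := by
    refine Finset.sum_le_sum fun j _ ↦ mul_le_mul_of_nonneg_right ?_ (hx j)
    have hj := hcols j (List.mem_range.mpr j.isLt)
    have hj' : (((List.zipWith (fun w v ↦ w * v.getD (↑j) 0) ws vs).sum + 1 : ℕ) : ℚ) ≤ ((ws.sum : ℕ) : ℚ) :=
      Nat.cast_le.mpr hj
    rw [Nat.cast_add, Nat.cast_one] at hj'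
    linarith
  have h4 : ∑ j : Fin 5, ((ws.sum : ℕ) - 1 : ℚ) * x j = ((ws.sum : ℕ) - 1 : ℚ) * m := by
    rw [← Finset.mul_sum, hsum]
  have hmq : (0 : ℚ) < m := by exact_mod_cast hm
  have key : ((ws.sum : ℕ) : ℚ) * m ≤ (((ws.sum : ℕ) : ℚ) - 1) * m := by
    calc ((ws.sum : ℕ) : ℚ) * m ≤ _ := h1
      _ = _ := h2
      _ ≤ _ := h3
      _ = _ := h4
  nlinarith

/-- Example of use: at `m = 11`, Shioda's `(1,1,5,7,8)` — no rational point `x ≥ 0`, `Σ x = 11`, has `v·x ≥ 11` for the three certificate vectors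
`(0,0,0,2,1)`, `(1,0,2,0,0)`, `(1,2,0,0,1)`. [folklore] -/
theorem no_fine_interior_point_eleven (x : Fin 5 → ℚ) (hx : ∀ j, 0 ≤ x j) (hsum : ∑ j, x j = 11)
    (hF : ∀ v ∈ [[0, 0, 0, 2, 1], [1, 0, 2, 0, 0], [1, 2, 0, 0, 1]], (11 : ℚ) ≤ dotQ v x) : False :=
  certOK_sound (c := ([1, 1, 5, 7, 8], [[0, 0, 0, 2, 1], [1, 0, 2, 0, 0], [1, 2, 0, 0, 1]], [1, 1, 1])) (by norm_num) (by decide) x hx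
    (by exact_mod_cast hsum) hF


/-! ### Assembly: at the nine kernel levels every level-one character is decomposable, quasi-decomposable, or a unit multiple of a CERTIFIED one

`ResidualWithin m reps` (the tree's complete residual lists, `ThreefoldConditionR.residual_<m>` / `ThreefoldResidualA/B/C`) + `certs_<m>_reps`
+ `certs_<m>_ok` (`GHC3Certificates`) give one quotable statement per level, `certified_<m>`; with `certOK_sound` each certificate forbids a
rational Fine-interior point. The Hodge-theoretic reading (decomposable / quasi-decomposable ⇒ Shioda 1983 (13); certified ⇒ uniruled quotient ⇒
coniveau 1) stays QUOTED. -/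

open Literature.AlgebraicGeometry.Shioda1983 (IsLevelOne IsDecomposable IsQuasiDecomposable ResidualWithin) in
open Summit.HodgeConjecture.FermatCycles.GHC3Certificates (toMultiset) in
/-- Every level-one character at level `m` is decomposable, quasi-decomposable, or a unit multiple of the character of a certificate in `certs`
that passes `certOK m`. [folklore] -/
def CertifiedWithin (m : ℕ) (certs : List Cert) : Prop :=
  ∀ s : Multiset (ZMod m), IsLevelOne s → IsDecomposable s ∨ IsQuasiDecomposable s ∨
    ∃ c ∈ certs, certOK m c = true ∧ ∃ t : (ZMod m)ˣ, s = (toMultiset m c).map (fun x ↦ (t : ZMod m) * x)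

open Literature.AlgebraicGeometry.Shioda1983 (ResidualWithin) in
open Summit.HodgeConjecture.FermatCycles.GHC3Certificates (toMultiset) in
/-- Assembly lemma: a complete residual list whose members are exactly the characters of `certOK`-passing certificates gives `CertifiedWithin`.
[folklore] -/
theorem certifiedWithin_of {m : ℕ} {reps : List (Multiset (ZMod m))} {certs : List Cert} (hres : ResidualWithin m reps)
    (hreps : certs.map (toMultiset m) = reps) (hok : certs.all (certOK m) = true) : CertifiedWithin m certs := by
  intro s hs
  rcases hres s hs with h | h | ⟨r, hr, t, hst⟩
  · exact Or.inl h
  · exact Or.inr (Or.inl h)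
  · rw [← hreps] at hr
    obtain ⟨c, hc, rfl⟩ := List.mem_map.mp hr
    exact Or.inr (Or.inr ⟨c, hc, List.all_eq_true.mp hok c hc, t, hst⟩)

open Summit.HodgeConjecture.FermatCycles.GHC3Certificates in
open Summit.HodgeConjecture.FermatCycles.ThreefoldConditionR in
open Summit.HodgeConjecture.FermatCycles.ThreefoldResidualA in
open Summit.HodgeConjecture.FermatCycles.ThreefoldResidualB in
open Summit.HodgeConjecture.FermatCycles.ThreefoldResidualC in
/-- **`m = 11`** (the level Shioda names, "we cannot verify it for m = 11" [Shioda1983WhatIsKnown, (13) p. 64]): every level-one character of `X³₁₁` is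
decomposable, quasi-decomposable, or a unit multiple of `(1,1,5,7,8)` or `(1,3,4,5,9)`, each of which carries a Fine-interior certificate (kernel).
Likewise at `m = 13, 15, 16, 17, 19, 21, 23, 24`. [cite: Shioda1983WhatIsKnown, (13) p. 64] -/
theorem certified_eleven : CertifiedWithin 11 certs_eleven := certifiedWithin_of residual_eleven certs_eleven_reps certs_eleven_ok

open Summit.HodgeConjecture.FermatCycles.GHC3Certificates Summit.HodgeConjecture.FermatCycles.ThreefoldConditionR in
/-- `m = 13`. [folklore] -/
theorem certified_thirteen : CertifiedWithin 13 certs_thirteen := certifiedWithin_of residual_thirteen certs_thirteen_reps certs_thirteen_ok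

open Summit.HodgeConjecture.FermatCycles.GHC3Certificates Summit.HodgeConjecture.FermatCycles.ThreefoldConditionR in
/-- `m = 15`. [folklore] -/
theorem certified_fifteen : CertifiedWithin 15 certs_fifteen := certifiedWithin_of residual_fifteen certs_fifteen_reps certs_fifteen_ok

open Summit.HodgeConjecture.FermatCycles.GHC3Certificates Summit.HodgeConjecture.FermatCycles.ThreefoldConditionR in
/-- `m = 16`. [folklore] -/
theorem certified_sixteen : CertifiedWithin 16 certs_sixteen := certifiedWithin_of residual_sixteen certs_sixteen_reps certs_sixteen_ok

open Summit.HodgeConjecture.FermatCycles.GHC3Certificates Summit.HodgeConjecture.FermatCycles.ThreefoldConditionR in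
/-- `m = 17`. [folklore] -/
theorem certified_seventeen : CertifiedWithin 17 certs_seventeen :=
  certifiedWithin_of residual_seventeen certs_seventeen_reps certs_seventeen_ok

open Summit.HodgeConjecture.FermatCycles.GHC3Certificates Summit.HodgeConjecture.FermatCycles.ThreefoldResidualA in
/-- `m = 19`. [folklore] -/
theorem certified_nineteen : CertifiedWithin 19 certs_nineteen := certifiedWithin_of residual_nineteen certs_nineteen_reps certs_nineteen_ok

open Summit.HodgeConjecture.FermatCycles.GHC3Certificates Summit.HodgeConjecture.FermatCycles.ThreefoldResidualA in
/-- `m = 21`. [folklore] -/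
theorem certified_twentyOne : CertifiedWithin 21 certs_twentyOne :=
  certifiedWithin_of residual_twentyOne certs_twentyOne_reps certs_twentyOne_ok

open Summit.HodgeConjecture.FermatCycles.GHC3Certificates Summit.HodgeConjecture.FermatCycles.ThreefoldResidualB in
/-- `m = 23`. [folklore] -/
theorem certified_twentyThree : CertifiedWithin 23 certs_twentyThree :=
  certifiedWithin_of residual_twentyThree certs_twentyThree_reps certs_twentyThree_ok

open Summit.HodgeConjecture.FermatCycles.GHC3Certificates Summit.HodgeConjecture.FermatCycles.ThreefoldResidualC in
/-- `m = 24`. [folklore] -/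
theorem certified_twentyFour : CertifiedWithin 24 certs_twentyFour :=
  certifiedWithin_of residual_twentyFour certs_twentyFour_reps certs_twentyFour_ok

end Summit.HodgeConjecture.FermatCycles.GHC3CertificateSoundness
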